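import Mathlib
import HarnessLib
import Literature.Analysis.FluidPDE.SelfSimilar
import Literature.Analysis.FluidPDE.VectorCalculus
import Literature.Analysis.FluidPDE.Vorticity
import Summits.NavierStokesRegularity.NavierStokesRegularity.Theses.ThreadingFlux
import Summits.NavierStokesRegularity.NavierStokesRegularity.Theorems.UnthreadedDoorKinematicShadowBoundedCurl

/-!
# Crux idea «kinematic-shadow» — typed sketch (planner ns-idea-15 g6, lens «negation»)

Crux: stmt-NavierStokesRegularity-1222 `…Theses.ThreadingFlux.PoloidalLiouville` (wall W1 = registered stub
`stub_scalarLiouville` of the antidynamo skeleton v2, ns-idea-6).  NS regularity is NOT proved; `PoloidalLiouville`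
and `stub_scalarLiouville` are OPEN; nothing in this file proves them.  Props + kernel-checked glue only, no `sorry`.

THE OBJECT.  The wall `StubScalarLiouville` (copied verbatim below as `WallShape`) is a Liouville statement for the
toroidal potential `T` of an unthreaded vorticity field `curl v = ∇T × (x − x₀)` obeying the exact law
(E1) `∇(∂ₜT + ⟪v,∇T⟫ − ΔT) × (x − x₀) = ∇⟪v, x − x₀⟫ × ∇T`.  (E1) is — symbol for symbol — the induction
equation `∂ₜB = curl(v × B) + ΔB` for the toroidal field `B = ∇T × (x − x₀)`; its derivation never uses `B = curl v`.
The KINEMATIC SHADOW of the wall is (E1) with the Biot–Savart coupling `curl v = ∇T × (x − x₀)` (and the NS class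
of `v`) DROPPED: `v` is any bounded, smooth, divergence-free drift.  It is LINEAR in `T` for fixed `v`, strictly
stronger than the wall (`wallShape_of_kinematicShadowAncient`, kernel), and it is Kaiser's «toroidal magnetic field
theorem» (CMP 290 (2009) 633, ball with insulating exterior) transplanted to ℝ³, where it is OPEN.

NEGATION RESULT TYPED HERE (paper proof in `Ideas/kinematic-shadow.md` §Proof): `HomogeneousToroidalNeverSteady` —
a scale-free toroidal field `B(x) = (∇_{S²}t)(ξ) × ξ` (`T = t(ξ)`, `ξ = (x−x₀)/‖x−x₀‖`, `t` with exactly two,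
non-degenerate, critical points) is NOT a steady solution of the induction equation on any shell `‖x − x₀‖ > R` for
ANY `C¹` incompressible drift whatsoever (bounded or not).  Mechanism («head transport»): on every sphere the scalar
law integrates over the sub-level sets of `t` to `α''V = Q'' + α'M` (α = spherical area distribution of `t`,
`Q(c) = ∮_{t=c}‖∇t‖`, `M` = loop momentum, `V = r²(N − c)` = head excess), the non-radial part of (E1) is the
transport `α'∂_cV = rα''∂_rV`, so `V` is constant on the curves `r·α'(c) = const`, each of which joins the minimum
(where `V = Δ_{S²}t > 0`) to the maximum (where `V = Δ_{S²}t < 0`): contradiction.  The spherical-envelope method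
(netflux/height-head) admits this class (`w = r·osc t` is an admissible eternal envelope) and the KNSS density needs
zonality, so the mechanism is new on this wall.

v1.1 (same session).  RUNG A′ `SpiralToroidalNeverSteady` (paper-proved, card §PROOF-A′): the same for potentials invariant
under a one-parameter group of SPIRAL similarities `x ↦ x₀ + e^s Φ_s(x − x₀)` (profile rotating with `log r`); rung A is its case
`Φ ≡ id` (`homogeneous_of_spiral`, kernel).  §B of the card (DRIFT ELIMINATION on unimodal shells): for a general potential whose
spherical restrictions have two non-degenerate critical points, (E1) + incompressibility force the pair (head excess `Ṽ`, loop
momentum `M`) to satisfy `Ṽ α_cc = M ∂_r(r α_c) + Q_cc − ∂_c ∂_r(r² α_r) + r² σ_cc` (algebraic) and `∂_c Ṽ = r ∂_r M`, where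
`α, Q, σ` are spherical distribution data of `T` ALONE; eliminating `M` leaves ONE linear transport equation for `Ṽ` with
Dirichlet data on BOTH critical-value curves — one explicit integral identity `Φ_T(Γ) = 0` per characteristic `Γ`, with the
drift gone.  RUNG C `AsymptoticallyHomogeneousNeverSteadyC4` (proof sketched via §B: far characteristics have vanishing sources,
end data → `Δ_{S²}t(p) > 0`, `Δ_{S²}t(q) < 0`).  `AsymptoticallyHomogeneousNeverSteady` (weighted C², v1.0) stays a CONJECTURE.
The shadow itself (`KinematicShadowSteady/Ancient`) remains OPEN both ways; NS regularity is NOT proved.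
-/

namespace Summit.NavierStokesRegularity.NavierStokesRegularity.Cruxes.PoloidalLiouville.KinematicShadow

open scoped BigOperators Topology Classical MeasureTheory InnerProductSpace RealInnerProductSpace
open Filter Set Function MeasureTheory
open Summit.NavierStokesRegularity.NavierStokesRegularity.Theses.ThreadingFlux

local notation "E" => EuclideanSpace ℝ (Fin 3)

/-- The steady KINEMATIC LAW on a set `U`: (E1) without `∂ₜ`, for a drift `u` and a potential `T`, i.e. the steady
induction equation `curl(u × B) + ΔB = 0` for `B = ∇T × (x − x₀)` written on the potential. -/
def SteadyKinematicLawOn (u : E → E) (T : E → ℝ) (x₀ : E) (U : Set E) : Prop :=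
  ∀ x ∈ U,
    Literature.Analysis.FluidPDE.cross
        (gradient (fun z => inner ℝ (u z) (gradient T z) - Laplacian.laplacian T z) x) (x - x₀) =
      Literature.Analysis.FluidPDE.cross (gradient (fun z => inner ℝ (u z) (z - x₀)) x) (gradient T x)

/-- The time-dependent KINEMATIC LAW on `(−∞,0) × (E ∖ {x₀})`: (E1) verbatim as in the wall, for a drift `u`. -/
def KinematicLaw (u : ℝ → E → E) (T : ℝ → E → ℝ) (x₀ : E) : Prop :=
  ∀ t < 0, ∀ x, x ≠ x₀ →
    Literature.Analysis.FluidPDE.cross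
        (gradient (fun z => deriv (fun s => T s z) t + inner ℝ (u t z) (gradient (T t) z)
          - Laplacian.laplacian (T t) z) x) (x - x₀) =
      Literature.Analysis.FluidPDE.cross (gradient (fun z => inner ℝ (u t z) (z - x₀)) x) (gradient (T t) x)

/-- RUNG (proved on paper, card §Proof; typed here): HOMOGENEOUS TOROIDAL FIELDS ARE NEVER STEADY.
Data: a `C³` potential `T`, 0-homogeneous about `x₀`, whose restriction to the unit sphere about `x₀` has exactly two
critical points `p` (minimum) and `q` (maximum), both non-degenerate (quadratic pinning); a `C¹` divergence-free drift
`u` on all of space (no bound assumed); the steady kinematic law on a shell `‖x − x₀‖ > R`.  Conclusion: impossible. -/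
def HomogeneousToroidalNeverSteady : Prop :=
  ∀ (u : E → E) (T : E → ℝ) (x₀ p q : E) (R κ : ℝ), 0 ≤ R → 0 < κ →
    ContDiff ℝ 1 u → Literature.Analysis.FluidPDE.VectorCalculus.IsDivFree u →
    ContDiffOn ℝ 3 T ({x₀}ᶜ : Set E) →
    (∀ x, x ≠ x₀ → ∀ s : ℝ, 0 < s → T (x₀ + s • (x - x₀)) = T x) →
    ‖p - x₀‖ = 1 → ‖q - x₀‖ = 1 →
    (∀ x, ‖x - x₀‖ = 1 → κ * ‖x - p‖ ^ 2 ≤ T x - T p ∧ κ * ‖x - q‖ ^ 2 ≤ T q - T x) →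
    (∀ x, ‖x - x₀‖ = 1 → gradient T x = 0 → x = p ∨ x = q) →
    SteadyKinematicLawOn u T x₀ {x | R < ‖x - x₀‖} →
    False

/-- ZONAL SUB-RUNG A_z (v1.2; critic ns-wall-crit-1 V20-P5 / 2026-08-29T02:08:22Z candidate signature, typed verbatim):
HOMOGENEOUS ZONAL TOROIDAL FIELDS ARE NEVER STEADY.  `T = t(⟪x − x₀, e⟫/‖x − x₀‖)` with `t ∈ C³`, `t′ > 0` on `(−1,1)` and
at both ends (non-degenerate poles), `u` ANY `C¹` divergence-free drift (not assumed axisymmetric, not assumed bounded), the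
steady kinematic law on a shell ⇒ impossible.  A literal special case of rung A (`HomogeneousToroidalNeverSteady`: poles =
the two non-degenerate critical points, κ = ½ min t′); TRUE on paper by V20; booked as the S/M KERNEL TARGET of the line
(Lean route: azimuthal average of the affine law about `e`, then the cap-flux identity in `c = cos θ`, sign contradiction at
the poles).  Information-grade no-go theorem in the LINEAR shadow; W1 movement 0; ⟨1222⟩ OPEN.  Not wired into `WallShape`. -/
def HomogeneousZonalToroidalNeverSteady : Prop :=
  ∀ (u : E → E) (t : ℝ → ℝ) (x₀ e : E) (R : ℝ), 0 ≤ R → ‖e‖ = 1 →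
    ContDiff ℝ 1 u → Literature.Analysis.FluidPDE.VectorCalculus.IsDivFree u → ContDiff ℝ 3 t →
    (∀ c ∈ Set.Ioo (-1 : ℝ) 1, 0 < deriv t c) → 0 < deriv t (-1) → 0 < deriv t 1 →
    SteadyKinematicLawOn u (fun x => t (inner ℝ (x - x₀) e / ‖x - x₀‖)) x₀ {x | R < ‖x - x₀‖} →
    False

/-- CONJECTURED NEXT RUNG (open; the live target of the line): ASYMPTOTICALLY homogeneous toroidal fields are never
steady under a BOUNDED `C¹` incompressible drift — `T(x₀ + rξ) → t(ξ)` in `C²(S²)` as `r → ∞` with `t` as above forces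
`t` constant.  Stated with an explicit remainder `T = t ∘ proj + ρ`, `‖ρ‖, r‖∇ρ‖, r²‖∇²ρ‖ → 0`. -/
def AsymptoticallyHomogeneousNeverSteady : Prop :=
  ∀ (u : E → E) (T Th ρ : E → ℝ) (x₀ p q : E) (κ K : ℝ), 0 < κ →
    ContDiff ℝ 1 u → Literature.Analysis.FluidPDE.VectorCalculus.IsDivFree u → (∀ x, ‖u x‖ ≤ K) →
    ContDiffOn ℝ 3 T ({x₀}ᶜ : Set E) → ContDiffOn ℝ 3 Th ({x₀}ᶜ : Set E) →
    (∀ x, x ≠ x₀ → ∀ s : ℝ, 0 < s → Th (x₀ + s • (x - x₀)) = Th x) →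
    (∀ x, x ≠ x₀ → T x = Th x + ρ x) →
    Tendsto (fun x : E => |ρ x| + ‖x - x₀‖ * ‖gradient ρ x‖ + ‖x - x₀‖ ^ 2 * ‖iteratedFDeriv ℝ 2 ρ x‖)
      (cocompact E) (𝓝 0) →
    ‖p - x₀‖ = 1 → ‖q - x₀‖ = 1 →
    (∀ x, ‖x - x₀‖ = 1 → κ * ‖x - p‖ ^ 2 ≤ Th x - Th p ∧ κ * ‖x - q‖ ^ 2 ≤ Th q - Th x) →
    (∀ x, ‖x - x₀‖ = 1 → gradient Th x = 0 → x = p ∨ x = q) →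
    SteadyKinematicLawOn u T x₀ ({x₀}ᶜ : Set E) →
    False

/-- RUNG A′ (proved on paper, card §PROOF-A′; contains `HomogeneousToroidalNeverSteady` as the case `Φ ≡ id`):
SPIRAL-HOMOGENEOUS TOROIDAL FIELDS ARE NEVER STEADY.  `T` is invariant under a one-parameter group of spiral similarities
`x ↦ x₀ + e^s · Φ_s (x − x₀)` (`Φ` a one-parameter group of linear isometries, i.e. rotations about an axis, or trivial), so
`T(x₀ + rη) = t(Φ_{−log r} η)`: the spherical profile ROTATES with `log r`.  Unit-sphere Morse data as in rung A, stated with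
the TANGENTIAL gradient (the radial derivative no longer vanishes).  Conclusion: no `C¹` incompressible drift keeps
`B = ∇T × (x − x₀)` steady on any shell. -/
def SpiralToroidalNeverSteady : Prop :=
  ∀ (u : E → E) (T : E → ℝ) (x₀ p q : E) (R κ : ℝ) (Φ : ℝ → E →ₗᵢ[ℝ] E), 0 ≤ R → 0 < κ →
    (∀ s s' : ℝ, Φ (s + s') = (Φ s).comp (Φ s')) → (∀ y : E, Continuous fun s : ℝ => Φ s y) →
    ContDiff ℝ 1 u → Literature.Analysis.FluidPDE.VectorCalculus.IsDivFree u →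
    ContDiffOn ℝ 3 T ({x₀}ᶜ : Set E) →
    (∀ x, x ≠ x₀ → ∀ s : ℝ, T (x₀ + Real.exp s • Φ s (x - x₀)) = T x) →
    ‖p - x₀‖ = 1 → ‖q - x₀‖ = 1 →
    (∀ x, ‖x - x₀‖ = 1 → κ * ‖x - p‖ ^ 2 ≤ T x - T p ∧ κ * ‖x - q‖ ^ 2 ≤ T q - T x) →
    (∀ x, ‖x - x₀‖ = 1 → gradient T x - (inner ℝ (gradient T x) (x - x₀)) • (x - x₀) = 0 → x = p ∨ x = q) →
    SteadyKinematicLawOn u T x₀ {x | R < ‖x - x₀‖} →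
    False

/-- RUNG C (paper proof SKETCHED via the drift-elimination identities of card §B; the honest regularity is weighted `C⁴`):
ASYMPTOTICALLY HOMOGENEOUS TOROIDAL FIELDS ARE NEVER STEADY, for ANY `C¹` incompressible drift (no bound on `u`).
`T = Th + ρ` off `x₀` with `Th` 0-homogeneous carrying the unit-sphere Morse data of rung A and
`Σ_{k ≤ 4} ‖x − x₀‖^k ‖D^k ρ(x)‖ → 0` at infinity. -/
def AsymptoticallyHomogeneousNeverSteadyC4 : Prop :=
  ∀ (u : E → E) (T Th ρ : E → ℝ) (x₀ p q : E) (κ : ℝ), 0 < κ →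
    ContDiff ℝ 1 u → Literature.Analysis.FluidPDE.VectorCalculus.IsDivFree u →
    ContDiffOn ℝ 4 T ({x₀}ᶜ : Set E) → ContDiffOn ℝ 4 Th ({x₀}ᶜ : Set E) →
    (∀ x, x ≠ x₀ → ∀ s : ℝ, 0 < s → Th (x₀ + s • (x - x₀)) = Th x) →
    (∀ x, x ≠ x₀ → T x = Th x + ρ x) →
    Tendsto (fun x : E => ∑ k ∈ Finset.range 5, ‖x - x₀‖ ^ k * ‖iteratedFDeriv ℝ k ρ x‖) (cocompact E) (𝓝 0) →
    ‖p - x₀‖ = 1 → ‖q - x₀‖ = 1 →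
    (∀ x, ‖x - x₀‖ = 1 → κ * ‖x - p‖ ^ 2 ≤ Th x - Th p ∧ κ * ‖x - q‖ ^ 2 ≤ Th q - Th x) →
    (∀ x, ‖x - x₀‖ = 1 → gradient Th x = 0 → x = p ∨ x = q) →
    SteadyKinematicLawOn u T x₀ ({x₀}ᶜ : Set E) →
    False

/-- THE KINEMATIC SHADOW OF THE WALL, steady form (OPEN; the dichotomy object of the card): a bounded `C¹`
incompressible drift cannot maintain a bounded steady toroidal field with bounded potential. -/
def KinematicShadowSteady : Prop :=
  ∀ (u : E → E) (T : E → ℝ) (x₀ : E) (K C : ℝ),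
    ContDiff ℝ 1 u → Literature.Analysis.FluidPDE.VectorCalculus.IsDivFree u → (∀ x, ‖u x‖ ≤ K) →
    ContDiffOn ℝ 3 T ({x₀}ᶜ : Set E) → (∀ x, |T x| ≤ C) →
    (∀ x, ‖Literature.Analysis.FluidPDE.cross (gradient T x) (x - x₀)‖ ≤ C) →
    SteadyKinematicLawOn u T x₀ ({x₀}ᶜ : Set E) →
    ∀ x, Literature.Analysis.FluidPDE.cross (gradient T x) (x - x₀) = 0

/-- THE KINEMATIC SHADOW OF THE WALL, ancient form (OPEN): the wall `StubScalarLiouville` with the NS class of the drift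
replaced by «bounded on `(−∞,0)`, weakly divergence-free slices, jointly smooth» and the coupling `curl v = ∇T × (x−x₀)`
DROPPED.  Linear in `T` for fixed `u`.  `KinematicShadowAncient → WallShape` is `wallShape_of_kinematicShadowAncient`. -/
def KinematicShadowAncient : Prop :=
  ∀ (u : ℝ → E → E) (x₀ : E) (T : ℝ → E → ℝ),
    Literature.Analysis.FluidPDE.IsBoundedOn (Set.Iio 0) u →
    (∀ t < 0, Literature.Analysis.FluidPDE.IsWeaklyDivFree (u t)) →
    ContDiffOn ℝ (⊤ : ℕ∞) (Function.uncurry u) (Set.Iio 0 ×ˢ Set.univ) →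
    ContDiffOn ℝ (⊤ : ℕ∞) (Function.uncurry T) (Set.Iio 0 ×ˢ ({x₀}ᶜ : Set E)) →
    (∃ C : ℝ, ∀ t < 0, ∀ x, |T t x| ≤ C) →
    (∃ C : ℝ, ∀ t < 0, ∀ x, ‖Literature.Analysis.FluidPDE.cross (gradient (T t) x) (x - x₀)‖ ≤ C) →
    KinematicLaw u T x₀ →
    ∀ t < 0, ∀ x, Literature.Analysis.FluidPDE.cross (gradient (T t) x) (x - x₀) = 0

/-- VERBATIM COPY of the wall `StubScalarLiouville` (antidynamo skeleton v2, ns-idea-6; the registered stub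
`stub_scalarLiouville` of crux stmt-NavierStokesRegularity-1222), so that the strengthening can be kernel-checked here. -/
def WallShape : Prop :=
  ∀ (v : ℝ → E → E) (x₀ : E) (T : ℝ → E → ℝ),
    Literature.Analysis.FluidPDE.IsBoundedAncientMildSolution 1 v →
    (∀ t < 0, AEStronglyMeasurable (v t) volume) →
    ContDiffOn ℝ (⊤ : ℕ∞) (Function.uncurry v) (Set.Iio 0 ×ˢ Set.univ) →
    ContDiffOn ℝ (⊤ : ℕ∞) (Function.uncurry T) (Set.Iio 0 ×ˢ ({x₀}ᶜ : Set E)) →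
    (∃ C : ℝ, ∀ t < 0, ∀ x, |T t x| ≤ C) →
    (∀ t < 0, ∀ x, Literature.Analysis.FluidPDE.curl (v t) x =
      Literature.Analysis.FluidPDE.cross (gradient (T t) x) (x - x₀)) →
    (∀ t < 0, ∀ x, x ≠ x₀ →
      Literature.Analysis.FluidPDE.cross
          (gradient (fun z => deriv (fun s => T s z) t + inner ℝ (v t z) (gradient (T t) z)
            - Laplacian.laplacian (T t) z) x) (x - x₀) =
        Literature.Analysis.FluidPDE.cross (gradient (fun z => inner ℝ (v t z) (z - x₀)) x) (gradient (T t) x)) →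
    ∀ t < 0, ∀ x, Literature.Analysis.FluidPDE.cross (gradient (T t) x) (x - x₀) = 0

/-- BRIDGE statement (M, the antidynamo skeleton's `StubVorticityOfClass` second conjunct): bounded vorticity in the
class.  Needed only to feed the shadow's «‖B‖ bounded» binder; kept as an explicit hypothesis of the glue. -/
def BoundedCurlOfClass : Prop :=
  ∀ (v : ℝ → E → E),
    Literature.Analysis.FluidPDE.IsBoundedAncientMildSolution 1 v →
    (∀ t < 0, AEStronglyMeasurable (v t) volume) →
    ContDiffOn ℝ (⊤ : ℕ∞) (Function.uncurry v) (Set.Iio 0 ×ˢ Set.univ) →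
    ∃ K : ℝ, ∀ t < 0, ∀ x, ‖Literature.Analysis.FluidPDE.curl (v t) x‖ ≤ K

/-- KERNEL GLUE: the ancient kinematic shadow (plus the bounded-vorticity bridge of the antidynamo skeleton) implies the
wall shape — instantiate the drift with the NS solution itself; the NS class supplies boundedness and weak
divergence-freeness, the coupling hypothesis supplies `‖B‖ ≤ K`. -/
theorem wallShape_of_kinematicShadowAncient (hK : KinematicShadowAncient) (hB : BoundedCurlOfClass) : WallShape := by
  intro v x₀ T hv hmeas hsm hT hTb hcurl hlaw
  obtain ⟨K, hKb⟩ := hB v hv hmeas hsm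
  refine hK v x₀ T hv.2 (fun t ht => (hv.1).1 t ht) hsm hT hTb ⟨K, ?_⟩ hlaw
  intro t ht x
  rw [← hcurl t ht x]
  exact hKb t ht x

/-- BY NAME (v1.2): the bridge binder `BoundedCurlOfClass` is CLOSED by the landed p689111
`Theorems/UnthreadedDoorKinematicShadowBoundedCurl.lean` (ns-qj-p1 g5; second conjunct of `vorticityOfClass`, p629171). -/
theorem boundedCurlOfClass_holds : BoundedCurlOfClass :=
  Summit.NavierStokesRegularity.NavierStokesRegularity.Theorems.PoloidalLiouville.KinematicShadow.boundedCurlOfClass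

/-- Hence the kernel glue needs the shadow alone: `KinematicShadowAncient → WallShape` (the shadow itself stays OPEN and
wall-dominating — never a prover rung, V20-P2). -/
theorem wallShape_of_kinematicShadowAncient' (hK : KinematicShadowAncient) : WallShape :=
  wallShape_of_kinematicShadowAncient hK boundedCurlOfClass_holds

/-- Sanity glue: the steady shadow is the time-independent case of the ancient one is NOT claimed (different regularity
binders); but the homogeneous rung is an instance of the steady shadow's hypotheses only when `u` is bounded — recorded
as the trivial implication below for the BOUNDED homogeneous case. -/
theorem homogeneous_of_shadowSteady_bounded (h : KinematicShadowSteady) :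
    ∀ (u : E → E) (T : E → ℝ) (x₀ : E) (K C : ℝ),
      ContDiff ℝ 1 u → Literature.Analysis.FluidPDE.VectorCalculus.IsDivFree u → (∀ x, ‖u x‖ ≤ K) →
      ContDiffOn ℝ 3 T ({x₀}ᶜ : Set E) → (∀ x, |T x| ≤ C) →
      (∀ x, ‖Literature.Analysis.FluidPDE.cross (gradient T x) (x - x₀)‖ ≤ C) →
      SteadyKinematicLawOn u T x₀ ({x₀}ᶜ : Set E) →
      ∀ x, Literature.Analysis.FluidPDE.cross (gradient T x) (x - x₀) = 0 :=
  h

/-- KERNEL: rung A is the case `Φ ≡ id` of rung A′ (Euler's relation: a 0-homogeneous `T` has no radial derivative, so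
its tangential gradient on the unit sphere is its gradient). -/
theorem homogeneous_of_spiral (h : SpiralToroidalNeverSteady) : HomogeneousToroidalNeverSteady := by
  intro u T x₀ p q R κ hR hκ hu hdiv hT hhom hp hq hpin hcrit hlaw
  refine h u T x₀ p q R κ (fun _ => LinearIsometry.id) hR hκ (fun _ _ => rfl) (fun _ => continuous_const)
    hu hdiv hT ?_ hp hq hpin ?_ hlaw
  · intro x hx s
    simpa using hhom x hx (Real.exp s) (Real.exp_pos s)
  · intro x hx1 hgrad
    have hx : x ≠ x₀ := by
      intro h'
      rw [h', sub_self, norm_zero] at hx1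
      exact zero_ne_one hx1
    have hdiff : DifferentiableAt ℝ T x :=
      (hT.contDiffAt (isOpen_compl_singleton.mem_nhds hx)).differentiableAt (by norm_num)
    -- the radial derivative vanishes (Euler's relation for 0-homogeneous `T`)
    have hrad : inner ℝ (gradient T x) (x - x₀) = 0 := by
      have hγ : HasDerivAt (fun s : ℝ => x₀ + s • (x - x₀)) (x - x₀) 1 := by
        simpa using ((hasDerivAt_id (1:ℝ)).smul_const (x - x₀)).const_add x₀
      have hpt : x₀ + (1:ℝ) • (x - x₀) = x := by simp
      have hF : HasFDerivAt T (fderiv ℝ T x) (x₀ + (1:ℝ) • (x - x₀)) := by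
        rw [hpt]; exact hdiff.hasFDerivAt
      have h1 : HasDerivAt (fun s : ℝ => T (x₀ + s • (x - x₀))) ((fderiv ℝ T x) (x - x₀)) 1 :=
        hF.comp_hasDerivAt (1:ℝ) hγ
      have h2 : HasDerivAt (fun s : ℝ => T (x₀ + s • (x - x₀))) 0 1 := by
        have hev : (fun s : ℝ => T (x₀ + s • (x - x₀))) =ᶠ[𝓝 1] fun _ => T x := by
          filter_upwards [lt_mem_nhds (zero_lt_one' ℝ)] with s hs
          exact hhom x hx s hs
        exact (hasDerivAt_const (1:ℝ) (T x)).congr_of_eventuallyEq hev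
      have hzero : (fderiv ℝ T x) (x - x₀) = 0 := h1.unique h2
      rw [gradient, InnerProductSpace.toDual_symm_apply]
      exact hzero
    apply hcrit x hx1
    have : gradient T x - (inner ℝ (gradient T x) (x - x₀)) • (x - x₀) = gradient T x := by
      rw [hrad, zero_smul, sub_zero]
    rw [← this]; exact hgrad

end Summit.NavierStokesRegularity.NavierStokesRegularity.Cruxes.PoloidalLiouville.KinematicShadow
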